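import Summits.ResolutionOfSingularities.ResolutionOfSingularities.Theses.HomologicalConductor
import HarnessLib

/-!
# The `A₂ × 𝔸¹` certificate: the cohomology annihilator of the `A₂`-cylinder loses `u` at the
# closed points of the singular line (negative evidence for the MECHANISM of crux
# `HomologicalConductor.Globalisation`, stmt-ResolutionOfSingularities-16486; the crux itself is
# implied by the summit and is not refuted here)

Supports item stmt-ResolutionOfSingularities-16486 on the NEGATIVE lane. The crux's informal content
("the valuation-wise canonical ca-towers are the local rings of ONE normalised blow-up tower
`X_m → X`") needs the Iyengar–Takahashi cohomology annihilator `ca` to be Zariski-local up to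
normalised blow-up. The cusp-cylinder (`Negative.caSheaf_false`) kills locality of the IDEAL but not
of its normalised blow-up (transversal dimension one). The witness here has NORMAL two-dimensional
transversal type: `R = k[x,y,u,z]/(xy − u³)` (the `A₂`-cylinder, singular line `𝔮 = (x,y,u)`).

Ring-theoretic core, kernel-checked below (the paper wrapper — `ca(R_𝔮) = 𝔮R_𝔮` by Herzog's
direct-summand argument, hence `NBl_{ca}` = minimal resolution transversally, versus
`ca(R_𝔪)R_𝔮 ⊆ (x, y, u²)R_𝔮` at the closed point `𝔪 = (x,y,u,z)`, whose normalised blow-up has ONE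
exceptional divisor, so that no `X₁ → Spec R` has the level-1 towers as local rings — is the crux
workfile `NONLOCALITY-A2xA1.md` of `Cruxes/Globalisation/`):

* `a2Cylinder_isMatrixFactorization` — for every `c`, the block matrices
  `Φ_c = [[φ, z^c θ], [0, φ]]`, `Ψ_c = [[ψ, −z^c θ], [0, ψ]]` with `φ = [[x, u²], [u, y]]`,
  `ψ = adj φ = [[y, −u²], [−u, x]]`, `θ = [[0, u], [−1, 0]]` satisfy `Φ_c Ψ_c = Ψ_c Φ_c = (xy − u³)·1`
  (a `4 × 4` matrix factorisation of `f = xy − u³`; `M_c := coker Φ_c` is the self-extension of the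
  reflexive ideal `(x, u)` with class `z^c·θ`, a maximal Cohen–Macaulay `R`-module of rank two).
* `a2Cylinder_homotopy` — for `a ≥ c`, `z^a u · 1 = Φ_c K + N Ψ_c` with the explicit
  `K = z^{a−c}(E₄₁ − u E₃₂)`, `N = z^{a−c}(u E₃₂ − E₄₁)`: `z^a u` acts stably trivially on `M_c`.
* `a2Cylinder_certificate`, `a2Cylinder_certificate_mvPolynomial` — for `a < c` there are NO
  `K, N ∈ M₄(k[x,y,u,z])` with `z^a u · 1 = Φ_c K + N Ψ_c` (`k` any domain): the `(1,1)` and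
  `(1,3)` entries, restricted to the line `x = y = 0`, give `z^a = z^c·K₄₁(0,0,0,z) − N₁₂(0,0,0,z)`
  (after cancelling `u`, at `u = 0`) and `z^c·N₁₂(0,0,0,z) = 0` (at `u = 0`), impossible for
  `a < c`. The abstract form is stated for any commutative ring `A` mapping to `k[z][t]` with
  `x, y ↦ 0`, `u ↦ t`; the `MvPolynomial (Fin 4) k` form is its specialisation. By the homotopy
  criterion (Iyengar–Takahashi 2014, Rem. 2.13 / Lemma 2.14: `r` annihilates `Ext¹_R(M, ΩM)` iff
  `r·id_M` factors through the free cover iff `r·1 ∈ Φ M₄(P) + M₄(P) Ψ`) this says: `z^a u`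
  annihilates `Ext^{≥1}_R(M_c, −)` iff `a ≥ c`. Consequently `s·u ∉ ca(R_𝔪)` for every `s ∉ 𝔮`
  (take `c` larger than the `z`-adic order of `s(0,0,0,z)`), i.e. `(ca(R_𝔪) : u) ⊆ 𝔮 R_𝔪` and
  `u ∉ ca(R_𝔪)·R_𝔮`, whereas `u ∈ ca(R_𝔮)`.
* `a2Cylinder_certificate_of_not_dvd` — the same restriction argument for `ev r = g(z)·t` with
  `z^c ∤ g`: the exact content of `(ca(R_𝔪) : u) ⊆ 𝔮R_𝔪` (take `r = d·s·u`, `d(0) ≠ 0`).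
* `a2Transversal_homotopies` — `x, y, u` act stably trivially, UNIFORMLY (constant homotopies), on
  `coker φ ≅ (x, u)` and on `coker ψ ≅ (y, u)`: with Herzog's classification of the indecomposable
  maximal Cohen–Macaulay modules of the complete `A₂` singularity over any field (direct summands of
  `L[[s,t]] = R' ⊕ M₁ ⊕ M₂`) this gives `ca(R_𝔮) = (x, y, u)R_𝔮` at the generic point of the
  singular line — the transversal value that the closed points do not attain.

The singular line `k[z][t]` is modelled as `Polynomial (Polynomial k)` (outer variable `t = u|`,
`C X = z`), so that "set `u = 0`" is `Polynomial.eval 0` and the comparison of `z`-coefficients is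
`Polynomial.coeff`; the ambient `k[x,y,u,z]` is `MvPolynomial (Fin 4) k`.
-/

set_option linter.dupNamespace false
set_option autoImplicit false

namespace Summit.ResolutionOfSingularities.ResolutionOfSingularities.Theorems.Globalisation.Negative

open Polynomial

section identities

variable {A : Type*} [CommRing A]

/-- **`Φ_c Ψ_c = Ψ_c Φ_c = (xy − u³)·1`**: the block pair built from the `A₂` factorisation
`φ ψ = (xy − u³)·1` and the class `w·θ` (`θ = [[0,u],[−1,0]]`, `θψ = φθ`, here with an arbitrary
scalar `w`, in the application `w = z^c`) is a `4 × 4` matrix factorisation of `xy − u³` over any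
commutative ring. [cite: IyengarTakahashi2014, Example 2.8 (periodic resolutions over hypersurfaces)] -/
theorem a2Cylinder_isMatrixFactorization (x y u w : A) :
    (!![x, u ^ 2, 0, w * u; u, y, -w, 0; 0, 0, x, u ^ 2; 0, 0, u, y] : Matrix (Fin 4) (Fin 4) A) *
        (!![y, -(u ^ 2), 0, -(w * u); -u, x, w, 0; 0, 0, y, -(u ^ 2); 0, 0, -u, x] :
          Matrix (Fin 4) (Fin 4) A) =
      (x * y - u ^ 3) • (1 : Matrix (Fin 4) (Fin 4) A) ∧
    (!![y, -(u ^ 2), 0, -(w * u); -u, x, w, 0; 0, 0, y, -(u ^ 2); 0, 0, -u, x] :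
          Matrix (Fin 4) (Fin 4) A) *
        (!![x, u ^ 2, 0, w * u; u, y, -w, 0; 0, 0, x, u ^ 2; 0, 0, u, y] : Matrix (Fin 4) (Fin 4) A) =
      (x * y - u ^ 3) • (1 : Matrix (Fin 4) (Fin 4) A) := by
  constructor <;>
  · refine Matrix.ext fun i j => ?_
    fin_cases i <;> fin_cases j <;>
      simp [Matrix.mul_apply, Fin.sum_univ_four] <;> ring

/-- **`z^a u` is stably trivial on `coker Φ_c` as soon as `a ≥ c`**: writing `z^a = z^{a−c}·z^c`
(`v = z^{a−c}`, `w = z^c`), `v w u · 1 = Φ_c K + N Ψ_c` with `K = v(E₄₁ − u E₃₂)` and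
`N = v(u E₃₂ − E₄₁)`, over any commutative ring. [cite: IyengarTakahashi2014, Remark 2.13] -/
theorem a2Cylinder_homotopy (x y u v w : A) :
    ((v * w * u) • (1 : Matrix (Fin 4) (Fin 4) A)) =
      (!![x, u ^ 2, 0, w * u; u, y, -w, 0; 0, 0, x, u ^ 2; 0, 0, u, y] : Matrix (Fin 4) (Fin 4) A) *
          (!![0, 0, 0, 0; 0, 0, 0, 0; 0, -(v * u), 0, 0; v, 0, 0, 0] : Matrix (Fin 4) (Fin 4) A) +
        (!![0, 0, 0, 0; 0, 0, 0, 0; 0, v * u, 0, 0; -v, 0, 0, 0] : Matrix (Fin 4) (Fin 4) A) *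
          (!![y, -(u ^ 2), 0, -(w * u); -u, x, w, 0; 0, 0, y, -(u ^ 2); 0, 0, -u, x] :
            Matrix (Fin 4) (Fin 4) A) := by
  refine Matrix.ext fun i j => ?_
  fin_cases i <;> fin_cases j <;>
    simp <;> ring

/-- **The transversal `A₂` annihilators are uniform.** On the matrix factorisation
`φ = [[x, u²], [u, y]]`, `ψ = [[y, −u²], [−u, x]]` of `xy − u³` (`coker φ ≅ (x,u)`,
`coker ψ ≅ (y,u)`, the two non-free indecomposable maximal Cohen–Macaulay modules of the `A₂`
surface singularity), each of `x, y, u` is null-homotopic with CONSTANT homotopies: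
`r·1 = φ K + N ψ` and `r·1 = ψ K' + N' φ`. Hence the maximal ideal `(x, y, u)` annihilates all
stable `Hom`s between maximal Cohen–Macaulay modules of the (complete, any field) `A₂` singularity
and `ca = (x, y, u)` there. [cite: IyengarTakahashi2014, Remark 2.13] -/
theorem a2Transversal_homotopies (x y u : A) :
    (x • (1 : Matrix (Fin 2) (Fin 2) A) =
        !![x, u ^ 2; u, y] * !![1, 0; 0, 0] + !![0, 0; 0, 1] * !![y, -(u ^ 2); -u, x]) ∧
    (y • (1 : Matrix (Fin 2) (Fin 2) A) =
        !![x, u ^ 2; u, y] * !![0, 0; 0, 1] + !![1, 0; 0, 0] * !![y, -(u ^ 2); -u, x]) ∧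
    (u • (1 : Matrix (Fin 2) (Fin 2) A) =
        !![x, u ^ 2; u, y] * !![0, 1; 0, 0] + !![0, -1; 0, 0] * !![y, -(u ^ 2); -u, x]) ∧
    (x • (1 : Matrix (Fin 2) (Fin 2) A) =
        !![y, -(u ^ 2); -u, x] * !![0, 0; 0, 1] + !![1, 0; 0, 0] * !![x, u ^ 2; u, y]) ∧
    (y • (1 : Matrix (Fin 2) (Fin 2) A) =
        !![y, -(u ^ 2); -u, x] * !![1, 0; 0, 0] + !![0, 0; 0, 1] * !![x, u ^ 2; u, y]) ∧
    (u • (1 : Matrix (Fin 2) (Fin 2) A) =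
        !![y, -(u ^ 2); -u, x] * !![0, -1; 0, 0] + !![0, 1; 0, 0] * !![x, u ^ 2; u, y]) := by
  refine ⟨?_, ?_, ?_, ?_, ?_, ?_⟩ <;>
  · refine Matrix.ext fun i j => ?_
    fin_cases i <;> fin_cases j <;>
      simp

end identities

section certificate

variable {A : Type*} [CommRing A] {k : Type*} [CommRing k] [IsDomain k]

/-- **The `A₂`-cylinder certificate** (abstract form). Let `A` be a commutative ring with elements
`x, y, u, w, r` and a ring homomorphism `ev : A → k[z][t]` (`k` a domain; outer variable `t`,
inner variable `z`) with `ev x = ev y = 0`, `ev u = t`, `ev w = z^c`, `ev r = z^a·t` — the case in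
point being `A = k[x,y,u,z]`, `w = z^c`, `r = z^a u` and `ev` = "restrict to the singular line
`x = y = 0`". If `a < c` there are no `4 × 4` matrices `K, N` over `A` with `r · 1 = Φ K + N Ψ`,
`Φ = [[x, u², 0, w u], [u, y, −w, 0], [0, 0, x, u²], [0, 0, u, y]]`,
`Ψ = [[y, −u², 0, −w u], [−u, x, w, 0], [0, 0, y, −u²], [0, 0, −u, x]]` (`Φ Ψ = (xy − u³)·1`,
`a2Cylinder_isMatrixFactorization`). This is the statement "`z^a u` does NOT act stably trivially
on the maximal Cohen–Macaulay module `coker Φ_c` of `k[x,y,u,z]/(xy − u³)`" (sharp: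
`a2Cylinder_homotopy`), the computational core of `s·u ∉ ca(R_𝔪)` for every `s ∉ (x, y, u)` at
the closed point `𝔪 = (x,y,u,z)` of the singular line of the `A₂`-cylinder. Proof: the `(1,1)`
entry restricted to the line and divided by `t` gives `z^a = z^c·K₄₁(0,z) − N₁₂(0,z) + t·(…)`, the
`(1,3)` entry gives `z^c·N₁₂(0,z) = 0` at `t = 0`; compare the coefficient of `z^a`.
[cite: IyengarTakahashi2014, Remark 2.13 and Lemma 2.14] -/
theorem a2Cylinder_certificate (ev : A →+* Polynomial (Polynomial k)) (x y u w r : A) (a c : ℕ)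
    (hac : a < c) (hx : ev x = 0) (hy : ev y = 0) (hu : ev u = X) (hw : ev w = C X ^ c)
    (hr : ev r = C X ^ a * X) (K N : Matrix (Fin 4) (Fin 4) A) :
    r • (1 : Matrix (Fin 4) (Fin 4) A) ≠
      (!![x, u ^ 2, 0, w * u; u, y, -w, 0; 0, 0, x, u ^ 2; 0, 0, u, y] : Matrix (Fin 4) (Fin 4) A) * K +
        N * (!![y, -(u ^ 2), 0, -(w * u); -u, x, w, 0; 0, 0, y, -(u ^ 2); 0, 0, -u, x] :
          Matrix (Fin 4) (Fin 4) A) := by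
  intro h
  -- the (0,0) and (0,2) entries of the matrix identity, restricted to the singular line
  have h00 := congrArg (fun M : Matrix (Fin 4) (Fin 4) A => ev (M 0 0)) h
  have h02 := congrArg (fun M : Matrix (Fin 4) (Fin 4) A => ev (M 0 2)) h
  simp [Matrix.mul_apply, Matrix.vecMul, dotProduct, Fin.sum_univ_four, hx, hy, hu, hw, hr] at h00 h02
  -- h00 : z^a·t = t²·K₁₀ + z^c·t·K₃₀ − N₀₁·t ;  h02 : 0 = t²·K₁₂ + z^c·t·K₃₂ + N₀₁·z^c − N₀₃·t
  -- (1) cancel `t` in the (0,0) entry (the line `k[z][t]` is a domain)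
  have e1 : X * ev (K 1 0) + C X ^ c * ev (K 3 0) - ev (N 0 1) = C X ^ a := by
    have hX : (X : Polynomial (Polynomial k)) *
        (X * ev (K 1 0) + C X ^ c * ev (K 3 0) - ev (N 0 1) - C X ^ a) = 0 := by
      linear_combination -h00
    rcases mul_eq_zero.mp hX with h' | h'
    · exact absurd h' Polynomial.X_ne_zero
    · linear_combination h'
  -- (2) the (0,2) entry at `t = 0`: `N₀₁(z,0)·z^c = 0`, so `N₀₁(z,0) = 0`
  have e2 := congrArg (Polynomial.eval 0) h02
  simp only [eval_add, eval_mul, eval_pow, eval_C, eval_X, eval_neg, eval_zero, mul_zero,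
    zero_mul, add_zero, zero_add, neg_zero, ne_eq, OfNat.ofNat_ne_zero, not_false_eq_true,
    zero_pow] at e2
  have hn : Polynomial.eval 0 (ev (N 0 1)) = 0 := by
    rcases mul_eq_zero.mp e2.symm with h' | h'
    · exact h'
    · exact absurd h' (pow_ne_zero _ Polynomial.X_ne_zero)
  -- (3) the (0,0) relation at `t = 0`: `z^c · K₃₀(z,0) = z^a` in `k[z]`
  have e3 := congrArg (Polynomial.eval 0) e1
  simp only [eval_add, eval_sub, eval_mul, eval_pow, eval_C, eval_X, zero_mul, zero_add, hn,
    sub_zero] at e3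
  -- (4) compare the coefficient of `z^a`: `a < c` makes the left side vanish there
  have e4 := congrArg (fun q : Polynomial k => q.coeff a) e3
  simp only [coeff_X_pow_mul', not_le.mpr hac, if_false, coeff_X_pow, if_true] at e4
  exact zero_ne_one e4

/-- **The certificate for the polynomial ring `k[x,y,u,z]` itself** (`MvPolynomial (Fin 4) k`,
`x = X 0`, `y = X 1`, `u = X 2`, `z = X 3`): for `a < c`, `z^a u · 1 ∉ Φ_c M₄ + M₄ Ψ_c`.
[cite: IyengarTakahashi2014, Remark 2.13 and Lemma 2.14] -/
theorem a2Cylinder_certificate_mvPolynomial (a c : ℕ) (hac : a < c)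
    (K N : Matrix (Fin 4) (Fin 4) (MvPolynomial (Fin 4) k)) :
    ((MvPolynomial.X 3 ^ a * MvPolynomial.X 2 : MvPolynomial (Fin 4) k) •
        (1 : Matrix (Fin 4) (Fin 4) (MvPolynomial (Fin 4) k))) ≠
      (!![MvPolynomial.X 0, MvPolynomial.X 2 ^ 2, 0, MvPolynomial.X 3 ^ c * MvPolynomial.X 2;
          MvPolynomial.X 2, MvPolynomial.X 1, -(MvPolynomial.X 3 ^ c), 0;
          0, 0, MvPolynomial.X 0, MvPolynomial.X 2 ^ 2;
          0, 0, MvPolynomial.X 2, MvPolynomial.X 1] : Matrix (Fin 4) (Fin 4) (MvPolynomial (Fin 4) k)) * K +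
        N * (!![MvPolynomial.X 1, -(MvPolynomial.X 2 ^ 2), 0, -(MvPolynomial.X 3 ^ c * MvPolynomial.X 2);
              -(MvPolynomial.X 2), MvPolynomial.X 0, MvPolynomial.X 3 ^ c, 0;
              0, 0, MvPolynomial.X 1, -(MvPolynomial.X 2 ^ 2);
              0, 0, -(MvPolynomial.X 2), MvPolynomial.X 0] :
            Matrix (Fin 4) (Fin 4) (MvPolynomial (Fin 4) k)) :=
  a2Cylinder_certificate
    (MvPolynomial.eval₂Hom (Polynomial.C.comp Polynomial.C)
      (![0, 0, X, C X] : Fin 4 → Polynomial (Polynomial k)))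
    (MvPolynomial.X 0) (MvPolynomial.X 1) (MvPolynomial.X 2) (MvPolynomial.X 3 ^ c)
    (MvPolynomial.X 3 ^ a * MvPolynomial.X 2) a c hac (by simp) (by simp) (by simp)
    (by simp [Matrix.cons_val_three, Matrix.vecHead, Matrix.vecTail])
    (by simp [Matrix.cons_val_three, Matrix.cons_val_two, Matrix.vecHead, Matrix.vecTail]) K N

/-- **The `A₂`-cylinder certificate, general restriction.** Same setting as
`a2Cylinder_certificate`, but with `ev r = g(z)·t` for an ARBITRARY `g ∈ k[z]` not divisible by
`z^c` (the case in point: `r = d·s·u` with `d(0) ≠ 0`, `s ∉ (x,y,u)`, and `c` larger than the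
`z`-adic order of `d(0,0,0,z)·s(0,0,0,z)`): there are no `K, N` with `r·1 = Φ K + N Ψ`. This is the
exact ring-theoretic content of `(ca(R_𝔪) : u) ⊆ 𝔮R_𝔪` for the `A₂`-cylinder (`s·u ∈ ca(R_𝔪)` with
`s ∉ 𝔮` would give such `K, N` over `P_𝔪`, cleared of denominators). Proof: the two restricted
entries give `g = z^c·K₄₁(z,0) − N₁₂(z,0)` and `z^c·N₁₂(z,0) = 0`, so `z^c ∣ g`.
[cite: IyengarTakahashi2014, Remark 2.13 and Lemma 2.14] -/
theorem a2Cylinder_certificate_of_not_dvd (ev : A →+* Polynomial (Polynomial k)) (x y u w r : A)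
    (c : ℕ) (g : Polynomial k) (hg : ¬ X ^ c ∣ g) (hx : ev x = 0) (hy : ev y = 0) (hu : ev u = X)
    (hw : ev w = C X ^ c) (hr : ev r = C g * X) (K N : Matrix (Fin 4) (Fin 4) A) :
    r • (1 : Matrix (Fin 4) (Fin 4) A) ≠
      (!![x, u ^ 2, 0, w * u; u, y, -w, 0; 0, 0, x, u ^ 2; 0, 0, u, y] : Matrix (Fin 4) (Fin 4) A) * K +
        N * (!![y, -(u ^ 2), 0, -(w * u); -u, x, w, 0; 0, 0, y, -(u ^ 2); 0, 0, -u, x] :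
          Matrix (Fin 4) (Fin 4) A) := by
  intro h
  have h00 := congrArg (fun M : Matrix (Fin 4) (Fin 4) A => ev (M 0 0)) h
  have h02 := congrArg (fun M : Matrix (Fin 4) (Fin 4) A => ev (M 0 2)) h
  simp [Matrix.mul_apply, Matrix.vecMul, dotProduct, Fin.sum_univ_four, hx, hy, hu, hw, hr] at h00 h02
  -- (1) cancel `t` in the (0,0) entry
  have e1 : X * ev (K 1 0) + C X ^ c * ev (K 3 0) - ev (N 0 1) = C g := by
    have hX : (X : Polynomial (Polynomial k)) *
        (X * ev (K 1 0) + C X ^ c * ev (K 3 0) - ev (N 0 1) - C g) = 0 := by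
      linear_combination -h00
    rcases mul_eq_zero.mp hX with h' | h'
    · exact absurd h' Polynomial.X_ne_zero
    · linear_combination h'
  -- (2) the (0,2) entry at `t = 0`
  have e2 := congrArg (Polynomial.eval 0) h02
  simp only [eval_add, eval_mul, eval_pow, eval_C, eval_X, eval_neg, eval_zero, mul_zero,
    zero_mul, add_zero, zero_add, neg_zero, ne_eq, OfNat.ofNat_ne_zero, not_false_eq_true,
    zero_pow] at e2
  have hn : Polynomial.eval 0 (ev (N 0 1)) = 0 := by
    rcases mul_eq_zero.mp e2.symm with h' | h'
    · exact h'
    · exact absurd h' (pow_ne_zero _ Polynomial.X_ne_zero)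
  -- (3) the (0,0) relation at `t = 0`: `z^c · K₃₀(z,0) = g`
  have e3 := congrArg (Polynomial.eval 0) e1
  simp only [eval_add, eval_sub, eval_mul, eval_pow, eval_C, eval_X, zero_mul, zero_add, hn,
    sub_zero] at e3
  exact hg ⟨Polynomial.eval 0 (ev (K 3 0)), e3.symm⟩

end certificate

end Summit.ResolutionOfSingularities.ResolutionOfSingularities.Theorems.Globalisation.Negative
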